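import Summits.QuantumFields.BalabanUV.Beta.MultiscaleRemainderLapTorus

/-!
# `Summit.QuantumFields.BalabanUV.Beta.TorusBoxProfile` — engine file 15a: circular arithmetic below half the period and the
# QUADRATIC PROFILE `φ(x) = Σ_μ δ_μ(x,x₀)²` on a coordinate box of the unit torus — `Σ_μ (φ(x+e_μ) + φ(x−e_μ)) = 2d·φ(x) + 2d`
# (the lattice identity `Δ_{ℤ^d}|x|² = 2d` read on `Π_μ ℤ/N_μ` one step beyond the box `dist(·,x₀) ≤ r`, `2r + 2 ≤ N_μ`) — the
# geometric input of the unit supersolution of file 15b `TorusBoxSupersolution` (item (DS) of the owner's decomposition E-an4-141a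
# of O.2 item (ii-b)) and of the box ∕ `d_n`-ball bookkeeping of the owner's file 16

HONEST FRAMING (page 1 of everything in this cell).  Discharging `FlowStep.BetaPertH` would make Bałaban's ultraviolet
stability UNCONDITIONAL — a constructive-QFT result; it is NOT the continuum limit and NOT the Clay problem.  This module
discharges nothing of `BetaPertH`; it is [folklore] lattice arithmetic, kernel-checked, by the OWNER of binder row D4 (unit
`b2b-balaban-beta-an4`, gen 45).  HONEST DEPENDENCY: continuum YM on T⁴ ⇐ BetaPertH ∧ nine spine estimates (0/9 proved);
BetaPertH ⇐ (D1) ∧ (D4) ∧ CAP+tail; G-an2-4 gates asym, D1 and NE2/3/4.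

WHAT IS CERTIFIED (kernel, 0 sorry, no `def` — the profile enters through the defining hypothesis
`hφ : ∀ x, φ x = Σ_ν (circAbs (N ν) (x_ν − x₀,ν))²`), on the unit torus `UT N` of `B5TorusCover` with the steps `up`∕`dn` of
`B5Leibniz121` and the circular distance `circAbs` of `B4TorusKernel.MultiPeriod`:
* §1 (one-dimensional) `circAbs_eq_abs_of_two_mul_abs_le` (`dist(u, Mℤ) = |u|` when `2|u| ≤ M`), `circAbs_add_one_le`,
  `circAbs_sub_one_le`, **`circAbs_sq_succ_add_sq_pred`** (`dist(t, Mℤ) ≤ r`, `2r + 2 ≤ M` ⟹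
  `dist(t+1)² + dist(t−1)² = 2·dist(t)² + 2` — via the centred representative);
* §2 the coordinates of `x ± e_μ` mod `N_μ` (`coord_up_self`, `coord_dn_self`, `coord_up_ne`, `coord_dn_ne`), the circular
  coordinate distances to a centre after a step (`cdist_up_self`, `cdist_dn_self`, `cdist_up_ne`, `cdist_dn_ne`) and
  `cdist_le_of_dist_le` (in the box `dist(x,x₀) ≤ r` every `δ_μ ≤ r`; `dist` on `UT N` is their supremum);
* §3 the profile: `profile_nonneg`, `profile_le_of_cdist_le`, `profile_le_of_mem` (`φ ≤ d·r²` on the box), `profile_up_le` ∕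
  `profile_dn_le` (`φ ≤ d·(r+1)²` one step beyond), **`sum_profile_up_add_dn`**.
LOCATORS (shape only; ABSOLUTE RULE — nothing printed is asserted): [Balaban1984PropagatorsI] p. 36 (the maximum-principle
flavour of the lattice arguments); [Balaban1985BackgroundPropagators] (3.23) p. 394.  Row D4: NO class change (critical-path
width 0; D4 DISCHARGE NO DATE); NOT BetaPertH, NOT continuum, NOT Clay, NOT summit progress.
-/

open scoped BigOperators
open Finset

namespace Summit.QuantumFields.BalabanUV.Beta.TorusBoxProfile

open Literature.MathematicalPhysics.QuantumFieldTheory.Balaban1983to89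
open B4TorusKernel.MultiPeriod (circAbs centre circAbs_nonneg circAbs_le_abs circAbs_add_mul abs_add_mul_centre)
open B4Sect5Torus (TSite tdist circAbs_le_tdist circAbs_add_le)
open B5TorusCover (UT)
open B5Leibniz121 (up dn up_dn)
open B5SmoothPartition (fin_val_add_one_rep)

noncomputable section

/-! ## §1 One-dimensional circular arithmetic below half the period -/

/-- Below half the period the circular distance is the absolute value: `2|u| ≤ M ⟹ dist(u, Mℤ) = |u|`. [folklore] -/
theorem circAbs_eq_abs_of_two_mul_abs_le {M : ℕ} (hM : 1 ≤ M) (u : ℤ) (h : 2 * |u| ≤ (M : ℤ)) :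
    circAbs M u = |u| := by
  unfold circAbs
  rcases le_or_gt 0 u with hu | hu
  · rw [abs_of_nonneg hu] at h ⊢
    have hlt : u < (M : ℤ) := by omega
    rw [Int.emod_eq_of_lt hu hlt, min_eq_left (by omega)]
  · rw [abs_of_neg hu] at h ⊢
    have h1 : u % (M : ℤ) = u + M := by
      have h2 : (u + (M : ℤ) * 1) % (M : ℤ) = u % (M : ℤ) := Int.add_mul_emod_self_left u M 1
      rw [mul_one] at h2
      rw [← h2, Int.emod_eq_of_lt (by omega) (by omega)]
    rw [h1, min_eq_right (by omega)]
    ring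

/-- One step raises the circular distance by at most one: `dist(t+1, Mℤ) ≤ dist(t, Mℤ) + 1`. [folklore] -/
theorem circAbs_add_one_le {M : ℕ} (hM : 1 ≤ M) (t : ℤ) : circAbs M (t + 1) ≤ circAbs M t + 1 := by
  have h1 := circAbs_add_le hM t 1
  have h2 := circAbs_le_abs hM (1 : ℤ)
  rw [abs_one] at h2
  omega

/-- `dist(t−1, Mℤ) ≤ dist(t, Mℤ) + 1`. [folklore] -/
theorem circAbs_sub_one_le {M : ℕ} (hM : 1 ≤ M) (t : ℤ) : circAbs M (t - 1) ≤ circAbs M t + 1 := by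
  have h1 := circAbs_add_le hM t (-1)
  rw [← sub_eq_add_neg] at h1
  have h2 := circAbs_le_abs hM (-1 : ℤ)
  rw [abs_neg, abs_one] at h2
  omega

/-- **`Δ_ℤ t² = 2` read on `ℤ/M` below half the period**: if `dist(t, Mℤ) ≤ r` and `2r + 2 ≤ M`, then
`dist(t+1, Mℤ)² + dist(t−1, Mℤ)² = 2·dist(t, Mℤ)² + 2` (pass to the centred representative `s`, `|s| ≤ r`, where all three
circular distances are absolute values). [folklore] -/
theorem circAbs_sq_succ_add_sq_pred {M r : ℕ} (hM : 2 * r + 2 ≤ M) (t : ℤ) (ht : circAbs M t ≤ r) :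
    circAbs M (t + 1) ^ 2 + circAbs M (t - 1) ^ 2 = 2 * circAbs M t ^ 2 + 2 := by
  have hM1 : 1 ≤ M := by omega
  have hM' : (2 * r + 2 : ℤ) ≤ (M : ℤ) := by exact_mod_cast hM
  set s : ℤ := t + M * centre M t with hs
  have habs : |s| = circAbs M t := abs_add_mul_centre hM1 t
  have h0 : circAbs M t = circAbs M s := by rw [hs, circAbs_add_mul]
  have h1 : circAbs M (t + 1) = circAbs M (s + 1) := by
    rw [hs, show t + (M : ℤ) * centre M t + 1 = (t + 1) + (M : ℤ) * centre M t by ring, circAbs_add_mul]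
  have h2 : circAbs M (t - 1) = circAbs M (s - 1) := by
    rw [hs, show t + (M : ℤ) * centre M t - 1 = (t - 1) + (M : ℤ) * centre M t by ring, circAbs_add_mul]
  have hsr : |s| ≤ r := by rw [habs]; exact ht
  have hs1 : |s + 1| ≤ r + 1 := (abs_add_le s 1).trans (by rw [abs_one]; linarith)
  have hs2 : |s - 1| ≤ r + 1 := (abs_sub s 1).trans (by rw [abs_one]; linarith)
  have e1 : circAbs M (s + 1) = |s + 1| := circAbs_eq_abs_of_two_mul_abs_le hM1 _ (by linarith)
  have e2 : circAbs M (s - 1) = |s - 1| := circAbs_eq_abs_of_two_mul_abs_le hM1 _ (by linarith)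
  have e0 : circAbs M s = |s| := circAbs_eq_abs_of_two_mul_abs_le hM1 _ (by linarith)
  rw [h1, h2, h0, e1, e2, e0, sq_abs, sq_abs, sq_abs]
  ring

/-! ## §2 The coordinates of `x ± e_μ` on the unit torus and the circular coordinate distances to a centre -/

section Torus

variable {d : ℕ} {N : Fin d → ℕ} [∀ i, NeZero (N i)]

/-- The `μ`-th coordinate of `x + e_μ` is `x_μ + 1 (mod N_μ)`. [folklore] -/
theorem coord_up_self (x : UT N) (μ : Fin d) :
    ∃ m : ℤ, ((UT.toSite N (up x μ) μ).val : ℤ) = ((UT.toSite N x μ).val : ℤ) + 1 + (N μ : ℤ) * m := by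
  have e : UT.toSite N (up x μ) μ = UT.toSite N x μ + 1 := by
    show Function.update (UT.toSite N x) μ (UT.toSite N x μ + 1) μ = _
    rw [Function.update_self]
  rw [e]
  exact fin_val_add_one_rep _

/-- The other coordinates of `x + e_μ` are those of `x`. [folklore] -/
theorem coord_up_ne (x : UT N) {μ ν : Fin d} (h : ν ≠ μ) : UT.toSite N (up x μ) ν = UT.toSite N x ν := by
  show Function.update (UT.toSite N x) μ (UT.toSite N x μ + 1) ν = _
  rw [Function.update_of_ne h]

/-- The `μ`-th coordinate of `x − e_μ` is `x_μ − 1 (mod N_μ)`. [folklore] -/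
theorem coord_dn_self (x : UT N) (μ : Fin d) :
    ∃ m : ℤ, ((UT.toSite N (dn x μ) μ).val : ℤ) = ((UT.toSite N x μ).val : ℤ) - 1 + (N μ : ℤ) * m := by
  obtain ⟨m, hm⟩ := coord_up_self (dn x μ) μ
  rw [up_dn] at hm
  exact ⟨-m, by linarith⟩

/-- The other coordinates of `x − e_μ` are those of `x`. [folklore] -/
theorem coord_dn_ne (x : UT N) {μ ν : Fin d} (h : ν ≠ μ) : UT.toSite N (dn x μ) ν = UT.toSite N x ν := by
  show Function.update (UT.toSite N x) μ (UT.toSite N x μ - 1) ν = _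
  rw [Function.update_of_ne h]

/-- The circular `μ`-distance to the centre after the step `+e_μ`: `δ_μ(x + e_μ, x₀) = dist(t_μ + 1, N_μℤ)`,
`t_μ = x_μ − x₀,μ`. [folklore] -/
theorem cdist_up_self (x x₀ : UT N) (μ : Fin d) :
    circAbs (N μ) (((UT.toSite N (up x μ) μ).val : ℤ) - ((UT.toSite N x₀ μ).val : ℤ)) =
      circAbs (N μ) ((((UT.toSite N x μ).val : ℤ) - ((UT.toSite N x₀ μ).val : ℤ)) + 1) := by
  obtain ⟨m, hm⟩ := coord_up_self x μ
  rw [hm, show ((UT.toSite N x μ).val : ℤ) + 1 + (N μ : ℤ) * m - ((UT.toSite N x₀ μ).val : ℤ) =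
    ((((UT.toSite N x μ).val : ℤ) - ((UT.toSite N x₀ μ).val : ℤ)) + 1) + (N μ : ℤ) * m by ring, circAbs_add_mul]

/-- `δ_μ(x − e_μ, x₀) = dist(t_μ − 1, N_μℤ)`. [folklore] -/
theorem cdist_dn_self (x x₀ : UT N) (μ : Fin d) :
    circAbs (N μ) (((UT.toSite N (dn x μ) μ).val : ℤ) - ((UT.toSite N x₀ μ).val : ℤ)) =
      circAbs (N μ) ((((UT.toSite N x μ).val : ℤ) - ((UT.toSite N x₀ μ).val : ℤ)) - 1) := by
  obtain ⟨m, hm⟩ := coord_dn_self x μ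
  rw [hm, show ((UT.toSite N x μ).val : ℤ) - 1 + (N μ : ℤ) * m - ((UT.toSite N x₀ μ).val : ℤ) =
    ((((UT.toSite N x μ).val : ℤ) - ((UT.toSite N x₀ μ).val : ℤ)) - 1) + (N μ : ℤ) * m by ring, circAbs_add_mul]

/-- `δ_ν(x + e_μ, x₀) = δ_ν(x, x₀)` for `ν ≠ μ`. [folklore] -/
theorem cdist_up_ne (x x₀ : UT N) {μ ν : Fin d} (h : ν ≠ μ) :
    circAbs (N ν) (((UT.toSite N (up x μ) ν).val : ℤ) - ((UT.toSite N x₀ ν).val : ℤ)) =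
      circAbs (N ν) (((UT.toSite N x ν).val : ℤ) - ((UT.toSite N x₀ ν).val : ℤ)) := by
  rw [coord_up_ne x h]

/-- `δ_ν(x − e_μ, x₀) = δ_ν(x, x₀)` for `ν ≠ μ`. [folklore] -/
theorem cdist_dn_ne (x x₀ : UT N) {μ ν : Fin d} (h : ν ≠ μ) :
    circAbs (N ν) (((UT.toSite N (dn x μ) ν).val : ℤ) - ((UT.toSite N x₀ ν).val : ℤ)) =
      circAbs (N ν) (((UT.toSite N x ν).val : ℤ) - ((UT.toSite N x₀ ν).val : ℤ)) := by
  rw [coord_dn_ne x h]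

/-- In the box `dist(x, x₀) ≤ r` every circular coordinate distance is `≤ r` (`dist` is their supremum). [folklore] -/
theorem cdist_le_of_dist_le {x x₀ : UT N} {r : ℕ} (hx : dist x x₀ ≤ r) (μ : Fin d) :
    circAbs (N μ) (((UT.toSite N x μ).val : ℤ) - ((UT.toSite N x₀ μ).val : ℤ)) ≤ r := by
  have h := circAbs_le_tdist (UT.one_le N) (UT.toSite N x) (UT.toSite N x₀) μ
  rw [← UT.dist_eq] at h
  exact_mod_cast h.trans hx

/-! ## §3 The quadratic profile `φ(x) = Σ_μ δ_μ(x,x₀)²` (through the defining hypothesis `hφ`) -/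

omit [∀ i, NeZero (N i)] in
/-- `φ ≥ 0`. [folklore] -/
theorem profile_nonneg (x₀ : UT N) (φ : UT N → ℝ)
    (hφ : ∀ x, φ x = ∑ ν, (circAbs (N ν) (((UT.toSite N x ν).val : ℤ) - ((UT.toSite N x₀ ν).val : ℤ)) : ℝ) ^ 2)
    (x : UT N) : 0 ≤ φ x := by
  rw [hφ]; exact Finset.sum_nonneg fun ν _ => sq_nonneg _

/-- If every circular coordinate distance of `y` to `x₀` is `≤ s` then `φ(y) ≤ d·s²`. [folklore] -/
theorem profile_le_of_cdist_le (x₀ : UT N) (φ : UT N → ℝ)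
    (hφ : ∀ x, φ x = ∑ ν, (circAbs (N ν) (((UT.toSite N x ν).val : ℤ) - ((UT.toSite N x₀ ν).val : ℤ)) : ℝ) ^ 2)
    {y : UT N} {s : ℝ} (hs : ∀ ν, (circAbs (N ν) (((UT.toSite N y ν).val : ℤ) - ((UT.toSite N x₀ ν).val : ℤ)) : ℝ) ≤ s) :
    φ y ≤ d * s ^ 2 := by
  rw [hφ]
  calc ∑ ν, (circAbs (N ν) (((UT.toSite N y ν).val : ℤ) - ((UT.toSite N x₀ ν).val : ℤ)) : ℝ) ^ 2
      ≤ ∑ _ν : Fin d, s ^ 2 := Finset.sum_le_sum fun ν _ =>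
        pow_le_pow_left₀ (by exact_mod_cast circAbs_nonneg (UT.one_le N ν) _) (hs ν) 2
    _ = d * s ^ 2 := by rw [Finset.sum_const, Finset.card_univ, Fintype.card_fin, nsmul_eq_mul]

/-- In the box: `φ(x) ≤ d·r²`. [folklore] -/
theorem profile_le_of_mem (x₀ : UT N) (φ : UT N → ℝ)
    (hφ : ∀ x, φ x = ∑ ν, (circAbs (N ν) (((UT.toSite N x ν).val : ℤ) - ((UT.toSite N x₀ ν).val : ℤ)) : ℝ) ^ 2)
    {x : UT N} {r : ℕ} (hx : dist x x₀ ≤ r) : φ x ≤ d * (r : ℝ) ^ 2 :=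
  profile_le_of_cdist_le x₀ φ hφ fun ν => by exact_mod_cast cdist_le_of_dist_le hx ν

/-- One step out of the box along `+e_μ`: `φ(x + e_μ) ≤ d·(r+1)²`. [folklore] -/
theorem profile_up_le (x₀ : UT N) (φ : UT N → ℝ)
    (hφ : ∀ x, φ x = ∑ ν, (circAbs (N ν) (((UT.toSite N x ν).val : ℤ) - ((UT.toSite N x₀ ν).val : ℤ)) : ℝ) ^ 2)
    {x : UT N} {r : ℕ} (hx : dist x x₀ ≤ r) (μ : Fin d) : φ (up x μ) ≤ d * ((r : ℝ) + 1) ^ 2 := by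
  refine profile_le_of_cdist_le x₀ φ hφ fun ν => ?_
  have h2 := cdist_le_of_dist_le hx ν
  by_cases hν : ν = μ
  · subst hν
    rw [cdist_up_self]
    have h1 := circAbs_add_one_le (UT.one_le N ν) (((UT.toSite N x ν).val : ℤ) - ((UT.toSite N x₀ ν).val : ℤ))
    have h3 : circAbs (N ν) ((((UT.toSite N x ν).val : ℤ) - ((UT.toSite N x₀ ν).val : ℤ)) + 1) ≤ r + 1 := by omega
    exact_mod_cast h3
  · rw [cdist_up_ne x x₀ hν]
    have h3 : (circAbs (N ν) (((UT.toSite N x ν).val : ℤ) - ((UT.toSite N x₀ ν).val : ℤ)) : ℝ) ≤ r := by exact_mod_cast h2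
    linarith

/-- One step out of the box along `−e_μ`: `φ(x − e_μ) ≤ d·(r+1)²`. [folklore] -/
theorem profile_dn_le (x₀ : UT N) (φ : UT N → ℝ)
    (hφ : ∀ x, φ x = ∑ ν, (circAbs (N ν) (((UT.toSite N x ν).val : ℤ) - ((UT.toSite N x₀ ν).val : ℤ)) : ℝ) ^ 2)
    {x : UT N} {r : ℕ} (hx : dist x x₀ ≤ r) (μ : Fin d) : φ (dn x μ) ≤ d * ((r : ℝ) + 1) ^ 2 := by
  refine profile_le_of_cdist_le x₀ φ hφ fun ν => ?_
  have h2 := cdist_le_of_dist_le hx ν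
  by_cases hν : ν = μ
  · subst hν
    rw [cdist_dn_self]
    have h1 := circAbs_sub_one_le (UT.one_le N ν) (((UT.toSite N x ν).val : ℤ) - ((UT.toSite N x₀ ν).val : ℤ))
    have h3 : circAbs (N ν) ((((UT.toSite N x ν).val : ℤ) - ((UT.toSite N x₀ ν).val : ℤ)) - 1) ≤ r + 1 := by omega
    exact_mod_cast h3
  · rw [cdist_dn_ne x x₀ hν]
    have h3 : (circAbs (N ν) (((UT.toSite N x ν).val : ℤ) - ((UT.toSite N x₀ ν).val : ℤ)) : ℝ) ≤ r := by exact_mod_cast h2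
    linarith

/-- **THE FREE LAPLACIAN OF THE PROFILE IS `2d` ON THE BOX**: if `dist(x,x₀) ≤ r` and `2r + 2 ≤ N_μ` for every `μ`, then
`Σ_μ (φ(x + e_μ) + φ(x − e_μ)) = 2d·φ(x) + 2d`. [folklore] -/
theorem sum_profile_up_add_dn (x₀ : UT N) (φ : UT N → ℝ)
    (hφ : ∀ x, φ x = ∑ ν, (circAbs (N ν) (((UT.toSite N x ν).val : ℤ) - ((UT.toSite N x₀ ν).val : ℤ)) : ℝ) ^ 2)
    {r : ℕ} (hr : ∀ μ, 2 * r + 2 ≤ N μ) {x : UT N} (hx : dist x x₀ ≤ r) :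
    ∑ μ, (φ (up x μ) + φ (dn x μ)) = 2 * d * φ x + 2 * d := by
  -- coordinatewise: `φ(x ± e_μ) − φ(x)` sees only the `μ`-th term
  have key : ∀ μ, φ (up x μ) + φ (dn x μ) = 2 * φ x + 2 := by
    intro μ
    set g : UT N → Fin d → ℝ := fun y ν =>
      (circAbs (N ν) (((UT.toSite N y ν).val : ℤ) - ((UT.toSite N x₀ ν).val : ℤ)) : ℝ) ^ 2 with hg
    have hφ' : ∀ y, φ y = g y μ + ∑ ν ∈ univ.erase μ, g y ν := fun y => by
      rw [hφ, ← Finset.add_sum_erase _ _ (mem_univ μ)]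
    have hup : ∑ ν ∈ univ.erase μ, g (up x μ) ν = ∑ ν ∈ univ.erase μ, g x ν :=
      Finset.sum_congr rfl fun ν hν => by simp only [hg]; rw [cdist_up_ne x x₀ (ne_of_mem_erase hν)]
    have hdn : ∑ ν ∈ univ.erase μ, g (dn x μ) ν = ∑ ν ∈ univ.erase μ, g x ν :=
      Finset.sum_congr rfl fun ν hν => by simp only [hg]; rw [cdist_dn_ne x x₀ (ne_of_mem_erase hν)]
    have h1d := circAbs_sq_succ_add_sq_pred (hr μ) _ (cdist_le_of_dist_le hx μ)
    have h1d' : (circAbs (N μ) ((((UT.toSite N x μ).val : ℤ) - ((UT.toSite N x₀ μ).val : ℤ)) + 1) : ℝ) ^ 2 +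
        (circAbs (N μ) ((((UT.toSite N x μ).val : ℤ) - ((UT.toSite N x₀ μ).val : ℤ)) - 1) : ℝ) ^ 2 =
        2 * (circAbs (N μ) (((UT.toSite N x μ).val : ℤ) - ((UT.toSite N x₀ μ).val : ℤ)) : ℝ) ^ 2 + 2 := by
      exact_mod_cast h1d
    have gup : g (up x μ) μ = (circAbs (N μ) ((((UT.toSite N x μ).val : ℤ) - ((UT.toSite N x₀ μ).val : ℤ)) + 1) : ℝ) ^ 2 := by
      simp only [hg]; rw [cdist_up_self]
    have gdn : g (dn x μ) μ = (circAbs (N μ) ((((UT.toSite N x μ).val : ℤ) - ((UT.toSite N x₀ μ).val : ℤ)) - 1) : ℝ) ^ 2 := by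
      simp only [hg]; rw [cdist_dn_self]
    rw [hφ' (up x μ), hφ' (dn x μ), hφ' x, hup, hdn, gup, gdn]
    linarith
  rw [Finset.sum_congr rfl fun μ _ => key μ, Finset.sum_const, Finset.card_univ, Fintype.card_fin, nsmul_eq_mul]
  ring

end Torus

end

end Summit.QuantumFields.BalabanUV.Beta.TorusBoxProfile
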